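import Summits.Ventures.PackingBounds.ThreePointCert.C6Td11Agg1
import Summits.Ventures.PackingBounds.ThreePointCert.C6Td11Agg2
import Summits.Ventures.PackingBounds.ThreePointCert.C6Td11Agg3
import Summits.Ventures.PackingBounds.ThreePointCert.C6Td11Agg4

/-!
# A(6, arccos 1/3) ≤ 34 (three-point bound, degree 11, kernel-checked): the certificate record and the claimed expansion data (aggregates in the Agg files)

Framing: lottery ticket; floor = certified bounds/negative ranges. Venture `PackingBounds` (cell
`pub-packcert`), three-point SDP family. Integer data of a feasible point of the Bachoc–Vallentin
semidefinite program (n = 6, s = 1/3, degree d = 11, symmetric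
sums of squares), derived by `pub-packcert-sdp/code/cert2lean.py` from the exact rational
certificate `sdp-n6-d11-s1-3-sym-lppolish-v1.json` of the cell (two independent exact verifiers + referee), in the
units of the kernel checker `ThreePointCert.Check` (soundness `ThreePointCert.Sound`). Generated
file: plain lists of integers / monomials.
-/

namespace Summit.Ventures.PackingBounds.ThreePointCert.C6Td11

open Literature.Geometry.DiscreteGeometry Literature.Geometry.DiscreteGeometry.PolyCert PolyCert.SPoly

/-- The three-point blocks. -/
def certF : List FBlk := [FBlk.mk 0 fw0, FBlk.mk 1 fw1, FBlk.mk 2 fw2, FBlk.mk 3 fw3, FBlk.mk 4 fw4, FBlk.mk 5 fw5, FBlk.mk 6 fw6, FBlk.mk 7 fw7, FBlk.mk 8 fw8, FBlk.mk 9 fw9, FBlk.mk 10 fw10, FBlk.mk 11 fw11]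

/-- The certificate record: `n = 6`, `d = 11`, `s = 1/3`, `S = 52`, `N = 34`, `A`, `B`, `F`, slacks. -/
def cert : Cert3 := Cert3.mk 6 11 1 3 52 34 certA 0 (0) 0 certF 829045967832256747449533117497344000 831654425272193603850916109218603166

/-- The claimed expansion data (validated in the `Expand` files). -/
def polys : CertPolys3 := CertPolys3.mk eFP eR0 eR1 eR2 eR3 eR4 eQ0 eQ1

end Summit.Ventures.PackingBounds.ThreePointCert.C6Td11
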